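import Summits.Schanuel.Schanuel.Theorems.ZilberEacGraphSurfaceEdge
import Summits.Schanuel.Schanuel.Theorems.ZilberEacGraphCurveDensity
import HarnessLib

/-!
# Non-split surfaces over a graph base, II: Zariski density for balanced and for
# `x`-equidegree fibre polynomials

HONEST FRAMING.  Cell `pub-schanuel` (Zilber's Exponential-Algebraic Closedness, case ladder;
host summit Schanuel), seat 2, gen 16.  We answer Mantova–Masser's "unprojected density" question
(PLMS 129 (2024) = arXiv:2303.05592, §1 p. 5; OPEN in general) for NON-SPLIT surfaces over a graph
base,

  `W(p; P) = {x₁ = p(x₀), P(x₀; y₀, y₁) = 0} ⊆ ℂ² × ℂ²`, `deg p ≥ 2`, `P ∈ ℂ[x, y₀, y₁]` irreducible,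

in two forms: `unprojectedDense_graphSurface_of_edge` (a BALANCED lower-left edge: user-supplied
edge data `(s, m_b)` whose top-`x`-degree edge polynomial has a nonzero root) and
`unprojectedDense_graphSurface_of_equidegree` (`P` is `x`-EQUIDEGREE on its `y`-support: every
`y`-monomial of `P` occurs with the maximal power `xᴺ`; e.g. every `P` of full support in a box of
degrees — the generic member of the case over a graph base — and every product `P ∈ ℂ[y₀, y₁]`,
`N = 0`).  The mechanism is the Newton-polygon escape of `ZilberEacGraphSurfaceEdge` /
`exists_escape_zeros_poly`; density is THEOREM G.  What is NOT covered (precisely): unbalanced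
edges (e.g. `y₀² + y₁² = x₀ + 2`), where the root equation needs a logarithmic correction.  NOT
Schanuel's conjecture (neither used nor implied; EAC ⇏ SC); `EC(3,2)` stays OPEN.
-/

noncomputable section

open Filter Topology Metric Set Complex MvPolynomial
open Literature.NumberTheory.Transcendental Literature.ModelTheory.Zilber
open Literature.ModelTheory.ExponentialFields

set_option linter.dupNamespace false

namespace Summit.Schanuel.Schanuel.Theorems

/-! ## Part A. Density from escaping exponential points; the certificate -/

/-- The parameter point of `w` is `(w(x₀), w(y₀), w(y₁))`. -/
theorem lcPt_eq_vec (w : Fin 2 ⊕ Fin 2 → ℂ) :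
    lcPt w = ![w (Sum.inl 0), w (Sum.inr 0), w (Sum.inr 1)] := by
  funext j
  refine Fin.cases ?_ (fun i => ?_) j
  · simp [lcPt]
  · fin_cases i <;> rfl

/-- **Density from escaping exponential points** (any `p`): if
`W = {x₁ = p(x₀), P(x₀; y₀, y₁) = 0}` is irreducible closed of dimension `≤ 2` and there are
solutions `z_k` of `P(z_k; e^{z_k}, e^{p(z_k)}) = 0` with `|Re z_k|/log(2 + ‖z_k‖) → ∞`, then the
exponential points of `W` are Zariski dense. (new) -/
theorem unprojectedDense_graphSurface_of_expPoints (p : Polynomial ℂ)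
    (P : MvPolynomial (Fin 3) ℂ) {z : ℕ → ℂ}
    (hz : ∀ k, MvPolynomial.eval ![z k, exp (z k), exp (p.eval (z k))] P = 0)
    (hgr : Tendsto (fun k => |(z k).re| / Real.log (2 + ‖z k‖)) atTop atTop)
    (hS : IsIrreducibleClosed ℂ {w : Fin 2 ⊕ Fin 2 → ℂ | w (Sum.inl 1) = p.eval (w (Sum.inl 0)) ∧
      MvPolynomial.eval ![w (Sum.inl 0), w (Sum.inr 0), w (Sum.inr 1)] P = 0})
    (hdim : zariskiDim ℂ {w : Fin 2 ⊕ Fin 2 → ℂ | w (Sum.inl 1) = p.eval (w (Sum.inl 0)) ∧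
      MvPolynomial.eval ![w (Sum.inl 0), w (Sum.inr 0), w (Sum.inr 1)] P = 0} ≤ (2 : ℕ)) :
    UnprojectedDense {w : Fin 2 ⊕ Fin 2 → ℂ | w (Sum.inl 1) = p.eval (w (Sum.inl 0)) ∧
      MvPolynomial.eval ![w (Sum.inl 0), w (Sum.inr 0), w (Sum.inr 1)] P = 0} := by
  set q : ℕ → Fin 2 ⊕ Fin 2 → ℂ := fun k =>
    Sum.elim ![z k, p.eval (z k)] ![exp (z k), exp (p.eval (z k))] with hq
  have hqS : ∀ k, q k ∈ {w : Fin 2 ⊕ Fin 2 → ℂ | w (Sum.inl 1) = p.eval (w (Sum.inl 0)) ∧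
      MvPolynomial.eval ![w (Sum.inl 0), w (Sum.inr 0), w (Sum.inr 1)] P = 0} := by
    intro k
    refine ⟨by simp [hq], ?_⟩
    have e : (![q k (Sum.inl 0), q k (Sum.inr 0), q k (Sum.inr 1)] : Fin 3 → ℂ) =
        ![z k, exp (z k), exp (p.eval (z k))] := by
      simp [hq]
    rw [e]; exact hz k
  have hqΓ : ∀ k, q k ∈ expGraph ℂ 2 := by
    intro k
    rw [mem_expGraph_iff]
    intro i
    rw [Literature.ModelTheory.ExponentialFields.ExponentialRing.complex_exp_eq]
    fin_cases i <;> simp [hq]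
  have hgr' : Tendsto (fun k => |(q k (Sum.inl 0)).re| / Real.log (2 + ‖q k (Sum.inl 0)‖))
      atTop atTop := by
    refine hgr.congr fun k => ?_
    simp [hq]
  exact unprojectedDense_of_growth hS hdim 0 hqS hqΓ hgr'

section Certificate

variable (p : Polynomial ℂ)

/-- **`W(p; P) = Z(θ⁻¹((P)))`** for the substitution `θ : x₀ ↦ t, x₁ ↦ p(t), yᵢ ↦ yᵢ`. -/
theorem graphSurface_eq_zeroLocus (P : MvPolynomial (Fin 3) ℂ) :
    {w : Fin 2 ⊕ Fin 2 → ℂ | w (Sum.inl 1) = p.eval (w (Sum.inl 0)) ∧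
      MvPolynomial.eval ![w (Sum.inl 0), w (Sum.inr 0), w (Sum.inr 1)] P = 0} =
    zeroLocus ℂ (Ideal.comap (aeval (Sum.elim ![MvPolynomial.X 0,
        Polynomial.aeval (MvPolynomial.X 0 : MvPolynomial (Fin 3) ℂ) p]
      (fun i => MvPolynomial.X (Fin.succ i)) : Fin 2 ⊕ Fin 2 → MvPolynomial (Fin 3) ℂ) :
        MvPolynomial (Fin 2 ⊕ Fin 2) ℂ →ₐ[ℂ] MvPolynomial (Fin 3) ℂ)
      (Ideal.span {P})) := by
  ext w
  rw [mem_zeroLocus_iff]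
  constructor
  · rintro ⟨hw1, hwP⟩ f hf
    rw [Ideal.mem_comap, Ideal.mem_span_singleton] at hf
    obtain ⟨r, hr⟩ := hf
    rw [← eval_lcPt_aeval_graphCurveSubst p hw1, hr, map_mul, lcPt_eq_vec, hwP, zero_mul]
  · intro h
    have hw1 : w (Sum.inl 1) = p.eval (w (Sum.inl 0)) := by
      have hmem : (MvPolynomial.X (Sum.inl 1) -
          Polynomial.aeval (MvPolynomial.X (Sum.inl 0) : MvPolynomial (Fin 2 ⊕ Fin 2) ℂ) p :
          MvPolynomial (Fin 2 ⊕ Fin 2) ℂ) ∈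
          Ideal.comap (aeval (Sum.elim ![MvPolynomial.X 0,
              Polynomial.aeval (MvPolynomial.X 0 : MvPolynomial (Fin 3) ℂ) p]
            (fun i => MvPolynomial.X (Fin.succ i)) : Fin 2 ⊕ Fin 2 → MvPolynomial (Fin 3) ℂ) :
              MvPolynomial (Fin 2 ⊕ Fin 2) ℂ →ₐ[ℂ] MvPolynomial (Fin 3) ℂ)
            (Ideal.span {P}) := by
        rw [Ideal.mem_comap]
        have e : aeval (Sum.elim ![MvPolynomial.X 0,
            Polynomial.aeval (MvPolynomial.X 0 : MvPolynomial (Fin 3) ℂ) p]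
            (fun i => MvPolynomial.X (Fin.succ i)) : Fin 2 ⊕ Fin 2 → MvPolynomial (Fin 3) ℂ)
            (MvPolynomial.X (Sum.inl 1) -
              Polynomial.aeval (MvPolynomial.X (Sum.inl 0) : MvPolynomial (Fin 2 ⊕ Fin 2) ℂ) p :
              MvPolynomial (Fin 2 ⊕ Fin 2) ℂ) = 0 := by
          rw [map_sub, ← Polynomial.aeval_algHom_apply, MvPolynomial.aeval_X, MvPolynomial.aeval_X]
          simp
        rw [e]; exact Ideal.zero_mem _
      have h1 := h _ hmem
      rw [map_sub, MvPolynomial.aeval_X, sub_eq_zero] at h1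
      rw [h1, aeval_polynomial_aeval_X]
    refine ⟨hw1, ?_⟩
    have hmem : (rename (Fin.cases (Sum.inl 0) (fun i => Sum.inr i) : Fin 3 → Fin 2 ⊕ Fin 2) P :
        MvPolynomial (Fin 2 ⊕ Fin 2) ℂ) ∈
        Ideal.comap (aeval (Sum.elim ![MvPolynomial.X 0,
            Polynomial.aeval (MvPolynomial.X 0 : MvPolynomial (Fin 3) ℂ) p]
          (fun i => MvPolynomial.X (Fin.succ i)) : Fin 2 ⊕ Fin 2 → MvPolynomial (Fin 3) ℂ) :
            MvPolynomial (Fin 2 ⊕ Fin 2) ℂ →ₐ[ℂ] MvPolynomial (Fin 3) ℂ)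
          (Ideal.span {P}) := by
      have hfg : ((Sum.elim ![MvPolynomial.X 0,
          Polynomial.aeval (MvPolynomial.X 0 : MvPolynomial (Fin 3) ℂ) p]
          (fun i => MvPolynomial.X (Fin.succ i)) : Fin 2 ⊕ Fin 2 → MvPolynomial (Fin 3) ℂ) ∘
          (Fin.cases (Sum.inl 0) (fun i => Sum.inr i) : Fin 3 → Fin 2 ⊕ Fin 2)) =
          MvPolynomial.X := by
        funext j
        refine Fin.cases ?_ (fun i => ?_) j
        · simp
        · simp
      rw [Ideal.mem_comap, aeval_rename, hfg, MvPolynomial.aeval_X_left_apply]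
      exact Ideal.mem_span_singleton_self _
    have h1 := h _ hmem
    rw [aeval_rename] at h1
    have e : (w ∘ (Fin.cases (Sum.inl 0) (fun i => Sum.inr i) : Fin 3 → Fin 2 ⊕ Fin 2)) =
        ![w (Sum.inl 0), w (Sum.inr 0), w (Sum.inr 1)] := by
      funext j
      refine Fin.cases ?_ (fun i => ?_) j
      · simp
      · fin_cases i <;> rfl
    rw [e] at h1
    rw [← MvPolynomial.coe_aeval_eq_eval]
    exact h1

variable {P : MvPolynomial (Fin 3) ℂ}

/-- **`W(p; P)` is an irreducible closed set** for irreducible `P ∈ ℂ[x, y₀, y₁]`. (new) -/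
theorem isIrreducibleClosed_graphSurface (hirr : Irreducible P) :
    IsIrreducibleClosed ℂ {w : Fin 2 ⊕ Fin 2 → ℂ | w (Sum.inl 1) = p.eval (w (Sum.inl 0)) ∧
      MvPolynomial.eval ![w (Sum.inl 0), w (Sum.inr 0), w (Sum.inr 1)] P = 0} := by
  have hprime : Prime P := UniqueFactorizationMonoid.irreducible_iff_prime.1 hirr
  haveI : (Ideal.span {P} : Ideal (MvPolynomial (Fin 3) ℂ)).IsPrime :=
    (Ideal.span_singleton_prime hprime.ne_zero).2 hprime
  haveI : (Ideal.comap (aeval (Sum.elim ![MvPolynomial.X 0,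
      Polynomial.aeval (MvPolynomial.X 0 : MvPolynomial (Fin 3) ℂ) p]
      (fun i => MvPolynomial.X (Fin.succ i)) : Fin 2 ⊕ Fin 2 → MvPolynomial (Fin 3) ℂ) :
        MvPolynomial (Fin 2 ⊕ Fin 2) ℂ →ₐ[ℂ] MvPolynomial (Fin 3) ℂ)
      (Ideal.span {P})).IsPrime := Ideal.IsPrime.comap _
  rw [graphSurface_eq_zeroLocus]
  exact isIrreducibleClosed_zeroLocus _

/-- **`dim W(p; P) = 2`**: `ℂ[W] ≅ ℂ[t, y₀, y₁]/(P)`. (new) -/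
theorem zariskiDim_graphSurface (hirr : Irreducible P) :
    zariskiDim ℂ {w : Fin 2 ⊕ Fin 2 → ℂ | w (Sum.inl 1) = p.eval (w (Sum.inl 0)) ∧
      MvPolynomial.eval ![w (Sum.inl 0), w (Sum.inr 0), w (Sum.inr 1)] P = 0} = (2 : ℕ) := by
  have hprime : Prime P := UniqueFactorizationMonoid.irreducible_iff_prime.1 hirr
  haveI : (Ideal.span {P} : Ideal (MvPolynomial (Fin 3) ℂ)).IsPrime :=
    (Ideal.span_singleton_prime hprime.ne_zero).2 hprime
  haveI : (Ideal.comap (aeval (Sum.elim ![MvPolynomial.X 0,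
      Polynomial.aeval (MvPolynomial.X 0 : MvPolynomial (Fin 3) ℂ) p]
      (fun i => MvPolynomial.X (Fin.succ i)) : Fin 2 ⊕ Fin 2 → MvPolynomial (Fin 3) ℂ) :
        MvPolynomial (Fin 2 ⊕ Fin 2) ℂ →ₐ[ℂ] MvPolynomial (Fin 3) ℂ)
      (Ideal.span {P})).IsPrime := Ideal.IsPrime.comap _
  rw [graphSurface_eq_zeroLocus, zariskiDim_zeroLocus_eq]
  set J : Ideal (MvPolynomial (Fin 3) ℂ) := Ideal.span {P} with hJ
  let f : MvPolynomial (Fin 2 ⊕ Fin 2) ℂ →ₐ[ℂ] (MvPolynomial (Fin 3) ℂ ⧸ J) :=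
    (Ideal.Quotient.mkₐ ℂ J).comp (aeval (Sum.elim ![MvPolynomial.X 0,
      Polynomial.aeval (MvPolynomial.X 0 : MvPolynomial (Fin 3) ℂ) p]
      (fun i => MvPolynomial.X (Fin.succ i)) : Fin 2 ⊕ Fin 2 → MvPolynomial (Fin 3) ℂ))
  have hf : Function.Surjective f :=
    (Ideal.Quotient.mkₐ_surjective ℂ J).comp (graphCurveSubst_surjective p)
  have hker : RingHom.ker f = Ideal.comap (aeval (Sum.elim ![MvPolynomial.X 0,
      Polynomial.aeval (MvPolynomial.X 0 : MvPolynomial (Fin 3) ℂ) p]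
      (fun i => MvPolynomial.X (Fin.succ i)) : Fin 2 ⊕ Fin 2 → MvPolynomial (Fin 3) ℂ) :
        MvPolynomial (Fin 2 ⊕ Fin 2) ℂ →ₐ[ℂ] MvPolynomial (Fin 3) ℂ) J := by
    ext q
    simp only [RingHom.mem_ker, Ideal.mem_comap, f, AlgHom.comp_apply,
      Ideal.Quotient.mkₐ_eq_mk, Ideal.Quotient.eq_zero_iff_mem]
  rw [← hker, ringKrullDim_eq_of_ringEquiv (Ideal.quotientKerAlgEquivOfSurjective hf).toRingEquiv,
    hJ, Literature.RingTheory.KrullDimension.ringKrullDim_quotient_span_of_prime_mvPolynomial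
      hprime]

end Certificate

/-! ## Part B. Density: balanced edge; equidegree -/

section Main

variable (p : Polynomial ℂ) {P : MvPolynomial (Fin 3) ℂ}

/-- **Density for a balanced edge.**  `deg p ≥ 2`, `P` irreducible, `(s, m_b)` lower-left edge
data of the `y`-support with top `x`-degree `n` on the edge whose edge polynomial is nonzero with a
root `θ ≠ 0` ⟹ the exponential points of `{x₁ = p(x₀), P(x₀; y₀, y₁) = 0}` are Zariski dense.
[cite: MantovaMasser2023, §1 Further remarks, p. 5 (the question, open in general)] (new) -/
theorem unprojectedDense_graphSurface_of_edge (hd : 2 ≤ p.natDegree) (hirr : Irreducible P)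
    {s : ℝ} {mb : Fin 3 →₀ ℕ}
    (hE1 : ∀ m ∈ P.support, ((mb 1 : ℝ) - s * mb 2) ≤ (m 1 : ℝ) - s * m 2)
    (hE2 : ∀ m ∈ P.support, ((m 1 : ℝ) - s * m 2) = (mb 1 : ℝ) - s * mb 2 → mb 2 ≤ m 2)
    (n : ℕ)
    (hn : ∀ m ∈ P.support, ((m 1 : ℝ) - s * m 2) = (mb 1 : ℝ) - s * mb 2 → m 0 ≤ n)
    {θ : ℂ} (hθ0 : θ ≠ 0)
    (hθ : (∑ m ∈ P.support.filter
        (fun m : Fin 3 →₀ ℕ => ((m 1 : ℝ) - s * m 2) = (mb 1 : ℝ) - s * mb 2),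
        Polynomial.C ((Polynomial.C (P.coeff m) * Polynomial.X ^ (m 0)).coeff n) *
          Polynomial.X ^ (m 2 - mb 2)).eval θ = 0)
    (hQ : (∑ m ∈ P.support.filter
        (fun m : Fin 3 →₀ ℕ => ((m 1 : ℝ) - s * m 2) = (mb 1 : ℝ) - s * mb 2),
        Polynomial.C ((Polynomial.C (P.coeff m) * Polynomial.X ^ (m 0)).coeff n) *
          Polynomial.X ^ (m 2 - mb 2)) ≠ 0) :
    UnprojectedDense {w : Fin 2 ⊕ Fin 2 → ℂ | w (Sum.inl 1) = p.eval (w (Sum.inl 0)) ∧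
      MvPolynomial.eval ![w (Sum.inl 0), w (Sum.inr 0), w (Sum.inr 1)] P = 0} := by
  obtain ⟨z, hz, hgr⟩ := exists_graphSurface_expPoints_of_edge p hd P hE1 hE2 n hn hθ0 hθ hQ
  exact unprojectedDense_graphSurface_of_expPoints p P hz hgr
    (isIrreducibleClosed_graphSurface p hirr) (by rw [zariskiDim_graphSurface p hirr])

/-- **Density for `x`-equidegree `P`.**  `deg p ≥ 2`; `P ∈ ℂ[x, y₀, y₁]` irreducible with two
monomials of different `y₁`-degree, all monomials of `x`-degree `≤ N`, and every `y`-monomial of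
`P` occurring with `xᴺ` (e.g. `P` of full support in a box, or `P ∈ ℂ[y₀, y₁]` with `N = 0`) ⟹
the exponential points of `{x₁ = p(x₀), P(x₀; y₀, y₁) = 0}` are Zariski dense — in general a
NON-SPLIT surface of Mantova–Masser's case.
[cite: MantovaMasser2023, §1 Further remarks, p. 5 (the question, open in general)] (new) -/
theorem unprojectedDense_graphSurface_of_equidegree (hd : 2 ≤ p.natDegree) (hirr : Irreducible P)
    (h2 : ∃ m ∈ P.support, ∃ m' ∈ P.support, m 2 ≠ m' 2) (N : ℕ)
    (hN : ∀ m ∈ P.support, m 0 ≤ N)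
    (htop : ∀ m ∈ P.support, ∃ m' ∈ P.support, m' 0 = N ∧ m' 1 = m 1 ∧ m' 2 = m 2) :
    UnprojectedDense {w : Fin 2 ⊕ Fin 2 → ℂ | w (Sum.inl 1) = p.eval (w (Sum.inl 0)) ∧
      MvPolynomial.eval ![w (Sum.inl 0), w (Sum.inr 0), w (Sum.inr 1)] P = 0} := by
  classical
  obtain ⟨s, mb, hmb, hE1, hE2, ms, hmsA, hms2, hmsw⟩ := exists_lowerLeft_edge₃ P.support h2
  set Qt : Polynomial ℂ := ∑ m ∈ P.support.filter
      (fun m : Fin 3 →₀ ℕ => ((m 1 : ℝ) - s * m 2) = (mb 1 : ℝ) - s * mb 2),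
      Polynomial.C ((Polynomial.C (P.coeff m) * Polynomial.X ^ (m 0)).coeff N) *
        Polynomial.X ^ (m 2 - mb 2) with hQt
  -- the top representatives of `m_b` and of the second edge point `m_s`
  obtain ⟨mb', hmb'A, hmb'0, hmb'1, hmb'2⟩ := htop mb hmb
  obtain ⟨ms', hms'A, hms'0, hms'1, hms'2⟩ := htop ms hmsA
  have hwb' : ((mb' 1 : ℝ) - s * mb' 2) = (mb 1 : ℝ) - s * mb 2 := by rw [hmb'1, hmb'2]
  have hws' : ((ms' 1 : ℝ) - s * ms' 2) = (mb 1 : ℝ) - s * mb 2 := by rw [hms'1, hms'2, hmsw]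
  have hcoef : ∀ m : Fin 3 →₀ ℕ, (Polynomial.C (P.coeff m) * Polynomial.X ^ (m 0)).coeff N =
      if N = m 0 then P.coeff m else 0 := fun m => by
    rw [Polynomial.coeff_C_mul, Polynomial.coeff_X_pow]; split_ifs <;> simp
  -- `Q_top(0) = c_{m_b'} ≠ 0`
  have hQ0 : Qt.eval 0 = P.coeff mb' := by
    rw [hQt, Polynomial.eval_finsetSum, Finset.sum_eq_single mb']
    · rw [hcoef, if_pos hmb'0.symm, hmb'2]; simp
    · intro m hm hne
      obtain ⟨hmA, hmw⟩ := Finset.mem_filter.1 hm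
      rw [hcoef]
      by_cases h0 : N = m 0
      · rw [if_pos h0]
        have hlt : mb 2 < m 2 := by
          rcases (hE2 m hmA hmw).lt_or_eq with h | h
          · exact h
          · exfalso
            exact hne (gse_eq_of_weight_eq (hmw.trans hwb'.symm) (h.symm.trans hmb'2.symm)
              (h0.symm.trans hmb'0.symm))
        have hpos : m 2 - mb 2 ≠ 0 := by omega
        simp [zero_pow hpos]
      · rw [if_neg h0]; simp
    · intro h
      exact (h (Finset.mem_filter.2 ⟨hmb'A, hwb'⟩)).elim
  have hQ0' : Qt.eval 0 ≠ 0 := by rw [hQ0]; exact MvPolynomial.mem_support_iff.1 hmb'A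
  -- `deg Q_top > 0`: the coefficient at `m_s₂ - (m_b)₂ ≥ 1` is `c_{m_s'} ≠ 0`
  have hlt : mb 2 < ms 2 := lt_of_le_of_ne (hE2 ms hmsA hmsw) (Ne.symm hms2)
  have hQd : 0 < Qt.natDegree := by
    refine lt_of_lt_of_le (by omega : 0 < ms 2 - mb 2) (Polynomial.le_natDegree_of_ne_zero ?_)
    rw [hQt, Polynomial.finsetSum_coeff, Finset.sum_eq_single ms']
    · rw [hcoef, if_pos hms'0.symm, Polynomial.coeff_C_mul, Polynomial.coeff_X_pow, hms'2,
        if_pos rfl, mul_one]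
      exact MvPolynomial.mem_support_iff.1 hms'A
    · intro m hm hne
      obtain ⟨hmA, hmw⟩ := Finset.mem_filter.1 hm
      rw [hcoef, Polynomial.coeff_C_mul, Polynomial.coeff_X_pow]
      by_cases h0 : N = m 0
      · rw [if_pos h0, if_neg]
        · simp
        · intro h
          have hle := hE2 m hmA hmw
          have h2' : m 2 = ms' 2 := by rw [hms'2]; omega
          exact hne (gse_eq_of_weight_eq (hmw.trans hws'.symm) h2' (h0.symm.trans hms'0.symm))
      · rw [if_neg h0]; simp
    · intro h
      exact (h (Finset.mem_filter.2 ⟨hms'A, hws'⟩)).elim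
  obtain ⟨θ, hθ⟩ := Complex.exists_root (Polynomial.natDegree_pos_iff_degree_pos.1 hQd)
  have hθ0 : θ ≠ 0 := by
    rintro rfl
    exact hQ0' hθ
  exact unprojectedDense_graphSurface_of_edge p hd hirr hE1 hE2 N
    (fun m hm _ => hN m hm) hθ0 hθ (Polynomial.ne_zero_of_natDegree_gt hQd)

end Main

end Summit.Schanuel.Schanuel.Theorems
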